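import Summits.QuantumFields.YangMills.Theorems.AlphaInputsT3ACv3Histories
import Summits.QuantumFields.Balaban3D.Proofs.Bound46AC
import HarnessLib

/-!
# `AlphaInputsT3ACv3Pint` — STUB 2″ clause (c) `PintSize` of crux `HistoryTailL` (stmt-QuantumFields-19936) AT THE v3 DATUM, PROVED from the v3 (α) rows:
# (46) p.267 «Σ_{j=1}^k Σ_{Y_j}|𝒫_j(Y_j, U_k)| ≤ O(1)M₁³g²_{k−1}p²(g_{k−1})|Λ_k|» for the package's AC tower (`Bound46AC`: old slice from the row (44) `h44` + floor `hfloor`,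
# newborn slice from G3D-01/(28)/G3D-06/`hPY`, G3D-07/`hPYZ`, G3D-08; thresholds from `g_k ≤ γ₀`) and its reading `|Pint_j(h, W)| ≤ CP·θBal(K − j + 1)²·(sitesPerDir j)³`
# with `CP := C46·M₁³` — lane `pub-balaban3d`, seat alpha-1 (g3)

§1 (lane-generic, ns `AlphaV3AC`): `abs_Pint_succ_le_of_alphaV3` — on the `≤`-family, `RunAlphaV3AC ⇒ |Pint_{k+1}(h, U)| ≤ (C46·M₁³)·(g_kp(g_k))²·#Ω_{k+1}^{(k+1)}(h)` for
every `k < K` (the same wiring serves `AlphaAC.RunAlphaAC`; only rows shared by both packages are read).  §2 (T³): `PkgAtV3.abs_Pint_succ_le`, and **`OfV3At.dataT3v3_pintSize :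
PintSize (dataT3v3 …) 𝔠.b₀ 𝔠.p₀ (𝔠.C46·M₁³)`** — `g_kp(g_k) = θBal(K − k)` (`PkgAtV3.eps1_eq`), `#Ω_{k+1}^{(k+1)}(h) ≤ #T^{(k+1)} = (sitesPerDir (k+1))³`; at `j = 0` the
schema is void (`1 ≤ j`), and `Adm` is not needed (the bound holds for every history and field).  Nothing of [Balaban1985UV3] is asserted: the (α) rows are the
hypothesis `h : OfV3At …` / `RunAlphaV3AC`.

References: T. Bałaban, Commun. Math. Phys. 102 (1985) 255–275 [Balaban1985UV3] ((33)–(34) p.264, (43)–(46) pp.266–267, (61) p.271).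
-/

set_option autoImplicit false

noncomputable section

namespace Summit.QuantumFields.YangMills.Theorems

open MeasureTheory
open scoped BigOperators
open Literature.MathematicalPhysics.QuantumFieldTheory.Balaban1983to89
open Literature.MathematicalPhysics.QuantumFieldTheory.Balaban1983to89.T3ContinuumYM3Torus
open Literature.MathematicalPhysics.QuantumFieldTheory.Balaban1983to89.T3UnitScaleTilt (θBal)
open Literature.MathematicalPhysics.QuantumFieldTheory.Balaban1983to89.T3AlphaInputsAC
open Literature.MathematicalPhysics.QuantumFieldTheory.Balaban1985CMP102
open Literature.MathematicalPhysics.QuantumFieldTheory.Balaban1985CMP102.Setting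
open Summit.QuantumFields.Balaban3D.Carriers
open Summit.QuantumFields.Balaban3D.Proofs.Primitives
open Summit.QuantumFields.Balaban3D.Proofs.ScalesArithmetic (gk_pos gk_le_one card_site_eq)
open Summit.QuantumFields.Balaban3D.Proofs.UVStability3DInputs (adjAct)
open Summit.QuantumFields.Balaban3D.Proofs.GroupModelLieC (lieC)
open Summit.QuantumFields.Balaban3D.Proofs.FamilyLE (thresholds_of_le)
open Summit.QuantumFields.Balaban3D.Proofs.TowerAC
open Summit.QuantumFields.Balaban3D.Proofs.StandardAC
open Summit.QuantumFields.Balaban3D.Proofs.InputsAC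
open Summit.QuantumFields.Balaban3D.Proofs.AlphaAC (AlphaDataAC)
open Summit.QuantumFields.Balaban3D.Proofs.Bound46AC (abs_pint_le_stdAC)

/-! ## §1 (46) one step up for the AC tower of a v3 package, on the `≤`-family -/

namespace AlphaV3AC

/-- The closed (46) constant of a record times `M₁³` equals the sum of the old-slice and newborn-slice constants. [folklore] -/
theorem _root_.Summit.QuantumFields.Balaban3D.Proofs.Primitives.AlphaConsts.C46_mul_M₁_cube_eq {L N : ℕ} (𝔠 : AlphaConsts L N) :
    𝔠.C46 * (𝔠.M₁ : ℝ) ^ 3 = 2 * 𝔠.C44 * (8 * (L : ℝ) ^ 2 * 𝔠.B₃ * 𝔠.Zfull) ^ 2 * ((L : ℝ) ^ 4 / ((L : ℝ) - 1)) + 𝔠.Cnew := by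
  have hM : (0 : ℝ) < 𝔠.M₁ := by exact_mod_cast 𝔠.M₁_pos
  unfold AlphaConsts.C46
  field_simp

variable {L : ℕ} {S : Scales L} {G : Type} [GaugeGroup G] [MeasurableSpace G] [HaarData G] {𝔊 : GroupModel G} {𝔠 : AlphaConsts L 𝔊.N}
  {X : ExternalInputsAC S G} {𝔖 : ∀ k, StepSeries S G ↥(lieC 𝔊) (nblkOf S 𝔠.lane.carrier k) k} {𝔄 : AlphaDataAC 𝔊 𝔠 X 𝔖}
  {win : (k : ℕ) → Hist S.P (k + 1) → Set (GaugeField S.P (k + 1) G)}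
  (hle : S.g ^ 2 * S.ε₀ ≤ (min 𝔠.gamma0 1) ^ 2)
include hle

/-- **(46) FOR THE AC TOWER OF A v3 PACKAGE, ONE STEP UP, every `k < K`** (on the `≤`-family `g²ε₀ ≤ (min γ₀ 1)²`): `|Pint_{k+1}(h, U)| ≤ (C46·M₁³)·(g_kp(g_k))²·#Ω_{k+1}^{(k+1)}(h)`
— `Bound46AC.abs_pint_le_stdAC` fed by the rows `h44`/`hfloor` (old slice), `chart`/`bound28`/`far_le`/`hPY`/`hPYZ` + the binders `𝔄.Λc`/`𝔄.N45` (newborn slice), the thresholds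
`γ₄₆` and the (28)-smallness from `g_k ≤ γ₀` (`FamilyLE.thresholds_of_le`). [cite: Balaban1985UV3, (44)–(46) p.267 + (33)–(34) p.264 + (61) p.271] -/
theorem abs_Pint_succ_le_of_alphaV3 (R : RunAlphaV3AC 𝔊 𝔠 X 𝔖 𝔄 win) (k : ℕ) (hk : k + 1 ≤ S.K) (h : Hist S.P (k + 1))
    (U : GaugeField S.P (k + 1) G) :
    |(inputOfAC 𝔠.lane X 𝔖).Pint (k + 1) h U| ≤
      (𝔠.C46 * (𝔠.M₁ : ℝ) ^ 3) * (S.gk k * B10.pFun 𝔠.b₀ 𝔠.p₀ (S.gk k)) ^ 2 * (LamFin 𝔠.lane.carrier.M₁ (rcolOf S 𝔠.lane.carrier) k h).card := by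
  rw [𝔠.C46_mul_M₁_cube_eq]
  exact abs_pint_le_stdAC X 𝔠.lane.carrier 𝔖 𝔠.C44_nonneg 𝔠.B₃_pos.le 𝔠.κ₁_pos 𝔠.M₁_pos 𝔠.b₀_pos 𝔠.p₀_pos 𝔠.chart
    (by linarith [𝔠.kappa_ge]) 𝔠.C25_nonneg 𝔠.C63_nonneg (lt_of_lt_of_le one_pos 𝔠.one_le_r₀)
    (fun j hj => (R.steps j hj).h44) (fun j hj => (R.steps j hj).hfloor) (fun j hj => (thresholds_of_le hle j (by omega)).2.1)
    (fun j hj => (R.steps j hj).chart) (fun j hj => (R.steps j hj).bound28) (fun j hj => (thresholds_of_le hle j (by omega)).2.2.2.2)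
    (fun j hj => (R.steps j hj).far_le) (fun j hj => (R.steps j hj).hPY) (π := fun j => adjAct 𝔊 (P := S.P) j) (fun j _ => 𝔄.Λc j)
    (fun j _ => 𝔄.N45 j) (fun j hj => (R.steps j hj).hPYZ) k hk h U

end AlphaV3AC

/-! ## §2 At the T³ package: `PintSize` for the v3 datum -/

section T3

variable {F : T3Family} {𝔠 : AlphaConsts F.L (suGroupModel 2).N} {γ : ℝ} {hγ : 0 < γ} {hγ1 : γ ≤ (min 𝔠.gamma0 1) ^ 2} {K : ℕ}

/-- **(46) FOR THE v3 RECORD'S TOWER, ONE STEP UP**: `|Pint_{k+1}(h, W)| ≤ (C46·M₁³)·θBal(K − k)²·#Ω_{k+1}^{(k+1)}(h)` for `k < K` (`g_kp(g_k) = θBal(K − k)`, `PkgAtV3.eps1_eq`).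
[cite: Balaban1985UV3, (46) p.267] -/
theorem AlphaInputsT3AC.PkgAtV3.abs_Pint_succ_le (p : AlphaInputsT3AC.PkgAtV3 F 𝔠 γ hγ hγ1 K) (k : ℕ) (hk : k + 1 ≤ K) (h : Hist (F.P K) (k + 1))
    (W : GaugeField (F.P K) (k + 1) (Matrix.specialUnitaryGroup (Fin 2) ℂ)) :
    |p.T.Pint (k + 1) h W| ≤ (𝔠.C46 * (𝔠.M₁ : ℝ) ^ 3) * θBal F.L γ 𝔠.b₀ 𝔠.p₀ (K - k) ^ 2 *
      (LamFin 𝔠.lane.carrier.M₁ (rcolOf (T3Scales F γ hγ (hγ1.trans (sq_min_one_le _ 𝔠.gamma0_pos)) K) 𝔠.lane.carrier) k h).card := by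
  have h46 := AlphaV3AC.abs_Pint_succ_le_of_alphaV3 (T3Scales_window F 𝔠 γ hγ hγ1 K) p.run k hk h W
  have hε : (T3Scales F γ hγ (hγ1.trans (sq_min_one_le _ 𝔠.gamma0_pos)) K).gk k *
      B10.pFun 𝔠.b₀ 𝔠.p₀ ((T3Scales F γ hγ (hγ1.trans (sq_min_one_le _ 𝔠.gamma0_pos)) K).gk k) = θBal F.L γ 𝔠.b₀ 𝔠.p₀ (K - k) := by
    rw [← p.eps1_eq k (by omega)]
    rfl
  rw [hε] at h46
  exact h46

/-- The top region of level `k + 1` has at most `(sitesPerDir (k+1))³ = #T^{(k+1)}` sites. [folklore] -/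
theorem card_lamFin_le_sitesPerDir_cube (M₁ : ℕ) (Rcol : ℕ → ℕ) (k : ℕ) (h : Hist (F.P K) (k + 1)) :
    ((LamFin M₁ Rcol k h).card : ℝ) ≤ ((F.P K).sitesPerDir (k + 1) : ℝ) ^ 3 := by
  have h1 : (LamFin M₁ Rcol k h).card ≤ Fintype.card (Site (F.P K) (k + 1)) := Finset.card_le_univ _
  have h2 : Fintype.card (Site (F.P K) (k + 1)) = (F.P K).sitesPerDir (k + 1) ^ 3 := Site.card_site _ _
  rw [h2] at h1
  exact_mod_cast h1

variable {a₀ a₁ : ℝ} (h : AlphaInputsT3AC.OfV3At F 𝔠 a₀ a₁) (hc : 0 < a₀ ∧ 0 < a₁ ∧ 𝔠.B₃ * a₁ ≤ a₀) (γ : ℝ) (hγ : 0 < γ)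
  (hγ1 : γ ≤ (min 𝔠.gamma0 1) ^ 2) (π : AlphaInputsT3AC.PolymerT3 F)

/-- **STUB 2″ CLAUSE (c) AT THE v3 DATUM — `PintSize` PROVED, with `CP := C46·M₁³`**: for every run `K`, level `1 ≤ j ≤ K`, history `h` and field `W`,
`|Pint^{(K)}_j(h, W)| ≤ CP·θBal(K − j + 1)²·(sitesPerDir j)³` — (46) p.267 for the package's AC tower (`PkgAtV3.abs_Pint_succ_le`) with the volume `|Λ_j| ≤ |T^{(j)}|`; the
schema's `Adm` guard is not used. [cite: Balaban1985UV3, (46) p.267] -/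
theorem AlphaInputsT3AC.OfV3At.dataT3v3_pintSize : PintSize (h.dataT3v3 hc γ hγ hγ1 π) 𝔠.b₀ 𝔠.p₀ (𝔠.C46 * (𝔠.M₁ : ℝ) ^ 3) := by
  intro K j r W hj hj1 _
  obtain ⟨k, rfl⟩ : ∃ k, j = k + 1 := ⟨j - 1, by omega⟩
  have h46 := (h.pkgAtV3 hc γ hγ hγ1 K).abs_Pint_succ_le k hj r W
  have hvol := card_lamFin_le_sitesPerDir_cube (F := F) (K := K) 𝔠.lane.carrier.M₁
    (rcolOf (T3Scales F γ hγ (hγ1.trans (sq_min_one_le _ 𝔠.gamma0_pos)) K) 𝔠.lane.carrier) k r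
  have hC : 0 ≤ 𝔠.C46 * (𝔠.M₁ : ℝ) ^ 3 * θBal F.L γ 𝔠.b₀ 𝔠.p₀ (K - k) ^ 2 :=
    mul_nonneg (mul_nonneg 𝔠.C46_nonneg (pow_nonneg (Nat.cast_nonneg _) _)) (sq_nonneg _)
  have hKk : K - (k + 1) + 1 = K - k := by omega
  show |(h.pkgAtV3 hc γ hγ hγ1 K).T.Pint (k + 1) r W| ≤ _
  rw [hKk]
  exact h46.trans (mul_le_mul_of_nonneg_left hvol hC)

end T3

end Summit.QuantumFields.YangMills.Theorems

end
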